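import Summits.ResolutionOfSingularities.ResolutionOfSingularities.Theorems.PerronInitialChartPrelim
import HarnessLib
/-! # PerronInitialChart — decomp-res node «PerronLadder» (lens-1 g18), tree file 8/11: PART V-E §21 KERNEL
`exists_initial_chart`, VERBATIM from `HOME/decomp-res-lens-1/g18/PerronLadder.lean` (sha256 8bb02ceefe11b749) l. 2887–3272:
a single 387-line declaration, alone in its file, hence the compressed preamble (400-line limit; one fully-qualified
name shortened under the `open`); provenance, critic rows 131/138 and the writer note as in `PerronInitialChartPrelim`.
PROVED modulo the named fact `CossartJannsenSaito2020Embedded`, 0 sorry.  (Sources: CossartJannsenSaito2020;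
KnafKuhlmann2005 arXiv:math/0304159 §4; Zariski1940 §B; Cutkosky arXiv:1404.7459 §2.1.) -/
open IsLocalRing Literature.AlgebraicGeometry.Resolution Summit.ResolutionOfSingularities.ResolutionOfSingularities.Theorems Summit.ResolutionOfSingularities.ResolutionOfSingularities.Theorems.PfaffLine Summit.ResolutionOfSingularities.ResolutionOfSingularities.Theorems.ToricLadder
open Finset CategoryTheory CategoryTheory.Limits AlgebraicGeometry TopologicalSpace Scheme.IdealSheafData
open scoped Classical
namespace Summit.ResolutionOfSingularities.ResolutionOfSingularities.Theorems.PerronLadder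
variable {k : Type} [Field k] {K : Type} [Field K] [Algebra k K]
/-- **KERNEL (mod the named fact CJS 2020 Thm. 1.4) · THE INITIAL CHART.**  Over a regular affine base
model `B₀ ⊆ O ∩ F₁` (`trdeg_k F₁ ≤ 3`), finitely many non-zero elements of `B₀` become MONOMIALS (times
units) in a regular system of parameters of a regular local chart `S ⊇ B₀` of `F₁` dominated by `O`:
embedded resolution of the surface `V(a₀ · ∏ W)` in the (at most three-dimensional, excellent) local
scheme `Spec (B₀)_𝔭` (Cossart–Jannsen–Saito 2020 Cor. 1.5, tree theorem
`stub_cjs2020Cor15_of_embedded` from the named fact `CossartJannsenSaito2020Embedded`, and the tree's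
`exists_localRing_monomial_of_embeddedResolution` adapted to dimension `≤ 3`), then the factoriality of
regular local rings (`exists_isUnit_mul_prod_pow_of_prod_mem_radical`). [folklore] -/
theorem exists_initial_chart (hCJS : CossartJannsenSaito2020Embedded.{0})
    (O : ValuationSubring K) (F₁ : IntermediateField k K) (htr : Algebra.trdeg k F₁ ≤ 3)
    (B₀ : Subalgebra k K) (hB₀O : B₀.toSubring ≤ O.toSubring)
    (hB₀F : ∀ y, y ∈ B₀ → y ∈ F₁) (hB₀fg : B₀.FG)
    (hfrac : ∀ y : K, y ∈ F₁ → ∃ a ∈ B₀, ∃ b ∈ B₀, b ≠ 0 ∧ y = a / b)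
    (hreg : IsRegularLocalRing
      (Localization.AtPrime (Ideal.comap (Subring.inclusion hB₀O) (maximalIdeal O))))
    (W : Finset K) (hW : ∀ w ∈ W, w ∈ B₀ ∧ w ≠ 0) :
    ∃ (S : Subalgebra k K) (d : ℕ) (t : Fin d → K), d ≤ 3 ∧ B₀ ≤ S ∧ RegChart O F₁ S ∧
      IsParamFamily O S t ∧ ∀ w ∈ W, IsMonomialIn O S t w := by
  classical
  have hB₀O' : ∀ y, y ∈ B₀ → y ∈ O := fun y hy => hB₀O (Subalgebra.mem_toSubring.mpr hy)
  set P₀ : Ideal B₀.toSubring := Ideal.comap (Subring.inclusion hB₀O) (maximalIdeal O) with hP₀def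
  haveI hP₀p : P₀.IsPrime := Ideal.comap_isPrime _ _
  have hmemP₀ : ∀ a : B₀.toSubring, a ∈ P₀ ↔ O.valuation (a : K) < 1 := fun a => by
    rw [hP₀def, Ideal.mem_comap, ValuationSubring.valuation_lt_one_iff]
    rfl
  have hval1 : ∀ a : B₀.toSubring, a ∉ P₀ → O.valuation (a : K) = 1 := fun a ha =>
    le_antisymm ((O.valuation_le_one_iff _).mpr (hB₀O a.2))
      (not_lt.mp (fun h => ha ((hmemP₀ a).mpr h)))
  by_cases hP₀bot : P₀ = ⊥
  · /- FIELD CASE: the valuation is trivial on `F₁ = Frac B₀`; the chart is `F₁` itself, with no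
    parameters. -/
    have hunitB : ∀ y, y ∈ B₀ → y ≠ 0 → O.valuation y = 1 := fun y hy hy0 =>
      hval1 ⟨y, Subalgebra.mem_toSubring.mpr hy⟩ (by
        rw [hP₀bot, Ideal.mem_bot]
        exact fun h => hy0 (congrArg Subtype.val h))
    have hF₁val : ∀ y : K, y ∈ F₁ → y ≠ 0 → O.valuation y = 1 := by
      intro y hy hy0
      obtain ⟨a, ha, b, hb, hb0, rfl⟩ := hfrac y hy
      have ha0 : a ≠ 0 := by rintro rfl; exact hy0 (zero_div _)
      rw [map_div₀, hunitB a ha ha0, hunitB b hb hb0, div_one]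
    have hF₁O : ∀ y : K, y ∈ F₁ → y ∈ O := by
      intro y hy
      rcases eq_or_ne y 0 with rfl | hy0
      · exact O.zero_mem
      · exact (O.valuation_le_one_iff y).mp (hF₁val y hy hy0).le
    let S : Subalgebra k K := F₁.toSubalgebra
    have hmemS : ∀ y, y ∈ S ↔ y ∈ F₁ := fun y => IntermediateField.mem_toSubalgebra F₁ y
    have hF : IsField S := (inferInstance : Field F₁).toIsField
    refine ⟨S, 0, Fin.elim0, by omega, fun y hy => (hmemS y).mpr (hB₀F y hy), ?_, ?_, ?_⟩
    · refine ⟨by letI := hF.toField; infer_instance,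
        fun y hy => hF₁O y ((hmemS y).mp (Subalgebra.mem_toSubring.mp hy)),
        fun y hy => (hmemS y).mp hy, ?_, ?_, B₀, hB₀fg, fun y hy => (hmemS y).mpr (hB₀F y hy), ?_⟩
      · intro r
        constructor
        · intro hr
          have hr0 : (r : K) ≠ 0 := fun h => hr.ne_zero (Subtype.ext h)
          exact hF₁val r ((hmemS r).mp r.2) hr0
        · intro hr
          have hr0 : r ≠ 0 := fun h => by
            rw [h, Subalgebra.coe_zero, map_zero] at hr
            exact zero_ne_one hr
          letI := hF.toField
          exact isUnit_iff_ne_zero.mpr hr0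
      · intro y hy
        exact ⟨y, (hmemS y).mpr hy, 1, S.one_mem, one_ne_zero, (div_one y).symm⟩
      · intro r hr
        obtain ⟨a, ha, b, hb, hb0, hab⟩ := hfrac r ((hmemS r).mp hr)
        exact ⟨a, ha, b, hb, hunitB b hb hb0, by rw [hab, div_mul_cancel₀ a hb0]⟩
    · refine ⟨fun i => Fin.elim0 i, 0, Fin.elim0, ringKrullDim_eq_zero_of_isField hF,
        fun j => Fin.elim0 j, ?_, fun i => Fin.elim0 i⟩
      intro r hr
      letI := hF.toField
      have : r = 0 := by
        by_contra h
        exact hr (isUnit_iff_ne_zero.mpr h)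
      rw [this]
      exact Ideal.zero_mem _
    · intro w hw
      obtain ⟨hwB, hw0⟩ := hW w hw
      exact ⟨w, (hmemS w).mpr (hB₀F w hwB), hunitB w hwB hw0, fun i => Fin.elim0 i, by simp⟩
  · /- BLOW-UP CASE: `R = (B₀)_𝔭` is a regular local excellent ring of dimension `1 ≤ n + 1 ≤ 3`. -/
    obtain ⟨a₀, ha₀P, ha₀0⟩ : ∃ a₀ : B₀.toSubring, a₀ ∈ P₀ ∧ a₀ ≠ 0 := by
      by_contra h
      push Not at h
      exact hP₀bot ((Submodule.eq_bot_iff _).mpr h)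
    let A₀ : Type := B₀.toSubring
    let R : Type := Localization.AtPrime P₀
    haveI : IsRegularLocalRing R := hreg
    haveI : IsDomain R := isDomain_of_isRegularLocalRing R
    let f₀ : A₀ →+* F₁ :=
      { toFun := fun a => ⟨(a : K), hB₀F _ (Subalgebra.mem_toSubring.mp a.2)⟩
        map_one' := rfl
        map_mul' := fun _ _ => rfl
        map_zero' := rfl
        map_add' := fun _ _ => rfl }
    have hf₀ : ∀ a : A₀, ((f₀ a : F₁) : K) = (a : K) := fun _ => rfl
    have hunits : ∀ y : P₀.primeCompl, IsUnit (f₀ y) := fun y => by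
      rw [isUnit_iff_ne_zero]
      intro h0
      have h1 := hval1 y y.2
      have h2 : ((y : A₀) : K) = 0 := by rw [← hf₀, h0]; rfl
      rw [h2, map_zero] at h1
      exact zero_ne_one h1
    letI : Algebra A₀ F₁ := f₀.toAlgebra
    let φ : R →+* F₁ := IsLocalization.lift (M := P₀.primeCompl) hunits
    letI algRF : Algebra R F₁ := φ.toAlgebra
    letI algRK : Algebra R K := ((algebraMap F₁ K).comp φ).toAlgebra
    haveI : IsScalarTower R F₁ K := IsScalarTower.of_algebraMap_eq (fun r => rfl)
    have hφK : ∀ a : A₀, algebraMap R K (algebraMap A₀ R a) = (a : K) := fun a => by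
      change ((φ (algebraMap A₀ R a) : F₁) : K) = _
      rw [show φ (algebraMap A₀ R a) = f₀ a from IsLocalization.lift_eq hunits a]
      exact hf₀ a
    have hval : ∀ (a : A₀) (b : P₀.primeCompl),
        algebraMap R K (IsLocalization.mk' R a b) = (a : K) * ((b : A₀) : K)⁻¹ ∧
          O.valuation ((b : A₀) : K) = 1 := by
      intro a b
      have hb : O.valuation ((b : A₀) : K) = 1 := hval1 b b.2
      have hb0 : ((b : A₀) : K) ≠ 0 := fun h0 => by rw [h0, map_zero] at hb; exact zero_ne_one hb
      refine ⟨?_, hb⟩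
      have h1 := IsLocalization.mk'_spec R a b
      have h2 := congrArg (algebraMap R K) h1
      rw [map_mul, hφK, hφK] at h2
      rw [← h2, mul_inv_cancel_right₀ hb0]
    have hRO : ∀ r : R, algebraMap R K r ∈ O := by
      intro r
      obtain ⟨⟨a, b⟩, rfl⟩ := IsLocalization.mk'_surjective P₀.primeCompl r
      obtain ⟨hab, hb⟩ := hval a b
      rw [hab]
      refine mul_mem (hB₀O a.2) ?_
      rw [← O.valuation_le_one_iff, map_inv₀, hb, inv_one]
    have hinjR : Function.Injective (algebraMap R F₁) := by
      change Function.Injective (IsLocalization.lift (M := P₀.primeCompl) hunits)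
      refine (IsLocalization.lift_injective_iff _).mpr fun a b => ⟨fun h => ?_, fun h => ?_⟩
      · rw [IsLocalization.injective R P₀.primeCompl_le_nonZeroDivisors h]
      · have h' : (a : K) = (b : K) := by rw [← hf₀, ← hf₀]; exact congrArg Subtype.val h
        rw [Subtype.ext h']
    have hRm : ∀ r : R, r ∈ maximalIdeal R ↔ O.valuation (algebraMap R K r) < 1 := by
      intro r
      obtain ⟨⟨a, b⟩, rfl⟩ := IsLocalization.mk'_surjective P₀.primeCompl r
      obtain ⟨hab, hb⟩ := hval a b
      rw [IsLocalization.AtPrime.mk'_mem_maximal_iff R P₀ a b, hab, map_mul, map_inv₀, hb, inv_one,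
        mul_one]
      exact hmemP₀ a
    -- excellence and dimension
    letI : Algebra k A₀ := show Algebra k B₀ from inferInstance
    haveI : Algebra.FiniteType k A₀ :=
      show Algebra.FiniteType k B₀ from B₀.fg_iff_finiteType.mp hB₀fg
    have hexc : IsExcellentRing R :=
      isExcellentRing_localization_atPrime (isExcellentRing_of_field k) P₀
    obtain ⟨dR, hdR⟩ : ∃ dR : ℕ, ringKrullDim R = dR := exists_nat_cast_eq_ringKrullDim (R := R)
    have hdR3 : dR ≤ 3 := by
      have h1 : ringKrullDim R ≤ ringKrullDim A₀ :=
        Literature.RingTheory.KrullDimension.ringKrullDim_localization_atPrime_le P₀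
      have h2 : ringKrullDim A₀ ≤ 3 :=
        ringKrullDim_le_of_fg_subset B₀ hB₀fg F₁ hB₀F htr
      rw [hdR] at h1
      exact_mod_cast h1.trans h2
    have ha₀m : algebraMap A₀ R a₀ ∈ maximalIdeal R :=
      (IsLocalization.AtPrime.to_map_mem_maximal_iff R P₀ a₀).mpr ha₀P
    have hdR0 : dR ≠ 0 := by
      intro h0
      rw [h0] at hdR
      haveI : Ring.KrullDimLE 0 R := ⟨le_of_eq (by change ringKrullDim R = _; rw [hdR])⟩
      have hmax : (⊥ : Ideal R).IsMaximal := Ideal.IsPrime.isMaximal' Ideal.isPrime_bot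
      have hm : maximalIdeal R = ⊥ := (IsLocalRing.eq_maximalIdeal hmax).symm
      have h1 := ha₀m
      rw [hm, Ideal.mem_bot] at h1
      exact ha₀0 (IsLocalization.injective R P₀.primeCompl_le_nonZeroDivisors (by rw [h1, map_zero]))
    obtain ⟨n, rfl⟩ : ∃ n, dR = n + 1 := ⟨dR - 1, by omega⟩
    have hn : n ≤ 2 := by omega
    -- the element to monomialize
    let wA : ∀ w ∈ W, A₀ := fun w hw => ⟨w, Subalgebra.mem_toSubring.mpr (hW w hw).1⟩
    let xA : A₀ := a₀ * ∏ w ∈ W.attach, wA w.1 w.2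
    have hxA0 : xA ≠ 0 := by
      refine mul_ne_zero ha₀0 (Finset.prod_ne_zero_iff.mpr fun w _ => ?_)
      intro h
      exact (hW w.1 w.2).2 (congrArg Subtype.val h)
    let xR : R := algebraMap A₀ R xA
    have hxR0 : xR ≠ 0 := fun h =>
      hxA0 (IsLocalization.injective R P₀.primeCompl_le_nonZeroDivisors (by rw [map_zero]; exact h))
    have hxRm : xR ∈ maximalIdeal R := by
      change algebraMap A₀ R (a₀ * _) ∈ _
      rw [map_mul]
      exact Ideal.mul_mem_right _ _ ha₀m
    -- THE CJS STEP
    obtain ⟨uu, huuF, -, R', instCR', instReg', instAlg', hinj', hR'O, hR'm, hlow, hup, d, z, α, u,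
        hu, hdim', hspan', hfact'⟩ :=
      exists_localRing_monomial_of_embeddedResolution_le
        (RadicialJung.CleanModels.stub_cjs2020Cor15_of_embedded
          hCJS)
        (R := R) (K := F₁) (E := K) hinjR hexc hn hdR O hRO hRm xR hxR0 hxRm
    haveI : IsDomain R' := isDomain_of_isRegularLocalRing R'
    have hR'v : ∀ r : R', O.valuation (algebraMap R' K r) ≤ 1 := fun r =>
      (O.valuation_le_one_iff _).mpr (hR'O r)
    have hR'unit : ∀ r : R', IsUnit r ↔ O.valuation (algebraMap R' K r) = 1 := by
      intro r
      rw [← not_iff_not, ← mem_nonunits_iff, ← IsLocalRing.mem_maximalIdeal, hR'm r]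
      exact ⟨fun h => h.ne, fun h => lt_of_le_of_ne (hR'v r) h⟩
    -- `B₀` and `k` inside the range of `R' → K`
    have hB₀range : ∀ y, y ∈ B₀ → ∃ r : R', algebraMap R' K r = y := fun y hy => by
      obtain ⟨r, hr⟩ := hlow _
        (show algebraMap R K (algebraMap A₀ R ⟨y, Subalgebra.mem_toSubring.mpr hy⟩) ∈
          Algebra.adjoin R (uu : Set K) from Subalgebra.algebraMap_mem _ _)
      exact ⟨r, by rw [hr, hφK]⟩
    have hkrange : ∀ c : k, algebraMap k K c ∈ Set.range (algebraMap R' K) := fun c =>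
      hB₀range _ (B₀.algebraMap_mem c)
    let S : Subalgebra k K := rangeSubalgebra (algebraMap R' K) hkrange
    have hmemS : ∀ y, y ∈ S ↔ ∃ r : R', algebraMap R' K r = y := fun y =>
      mem_rangeSubalgebra _ hkrange y
    have hB₀S : B₀ ≤ S := fun y hy => (hmemS y).mpr (hB₀range y hy)
    have huuS : (uu : Set K) ⊆ S := fun y hy => (hmemS y).mpr (hlow y (Algebra.subset_adjoin hy))
    let C : Subalgebra k K := B₀ ⊔ Algebra.adjoin k (uu : Set K)
    have hCfg : C.FG := hB₀fg.sup (Subalgebra.fg_adjoin_finset uu)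
    have hCS : C ≤ S := sup_le hB₀S (Algebra.adjoin_le huuS)
    -- the `R`-algebra `R[uu]` inside `F₁`; its elements are `C`-fractions with denominators in `B₀`
    have hRF : ∀ r : R, algebraMap R K r ∈ F₁ := fun r => (φ r).2
    have hadjF : ∀ y ∈ Algebra.adjoin R (uu : Set K), y ∈ F₁ := by
      intro y hy
      refine Algebra.adjoin_induction (fun u hu => ?_) (fun r => hRF r)
        (fun _ _ _ _ h1 h2 => add_mem h1 h2) (fun _ _ _ _ h1 h2 => mul_mem h1 h2) hy
      obtain ⟨u', hu'⟩ := huuF hu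
      rw [← hu']
      exact u'.2
    have hadjC : ∀ y ∈ Algebra.adjoin R (uu : Set K),
        ∃ c ∈ C, ∃ β ∈ B₀, O.valuation β = 1 ∧ y * β = c := by
      intro y hy
      refine Algebra.adjoin_induction ?_ ?_ ?_ ?_ hy
      · intro u hu
        exact ⟨u, (le_sup_right : Algebra.adjoin k (uu : Set K) ≤ C) (Algebra.subset_adjoin hu), 1,
          B₀.one_mem, by simp, by simp⟩
      · intro r
        obtain ⟨⟨a, b⟩, rfl⟩ := IsLocalization.mk'_surjective P₀.primeCompl r
        obtain ⟨hab, hb⟩ := hval a b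
        have hb0 : ((b : A₀) : K) ≠ 0 := fun h0 => by
          rw [h0, map_zero] at hb; exact zero_ne_one hb
        refine ⟨(a : K), (le_sup_left : B₀ ≤ C) (Subalgebra.mem_toSubring.mp a.2), ((b : A₀) : K),
          Subalgebra.mem_toSubring.mp (b : A₀).2, hb, ?_⟩
        rw [hab, inv_mul_cancel_right₀ hb0]
      · rintro y₁ y₂ - - ⟨c₁, hc₁, β₁, hβ₁, hv₁, h₁⟩ ⟨c₂, hc₂, β₂, hβ₂, hv₂, h₂⟩
        refine ⟨c₁ * β₂ + c₂ * β₁,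
          add_mem (mul_mem hc₁ ((le_sup_left : B₀ ≤ C) hβ₂))
            (mul_mem hc₂ ((le_sup_left : B₀ ≤ C) hβ₁)),
          β₁ * β₂, mul_mem hβ₁ hβ₂, by rw [map_mul, hv₁, hv₂, mul_one], ?_⟩
        rw [add_mul, ← h₁, ← h₂]
        ring
      · rintro y₁ y₂ - - ⟨c₁, hc₁, β₁, hβ₁, hv₁, h₁⟩ ⟨c₂, hc₂, β₂, hβ₂, hv₂, h₂⟩
        refine ⟨c₁ * c₂, mul_mem hc₁ hc₂, β₁ * β₂, mul_mem hβ₁ hβ₂,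
          by rw [map_mul, hv₁, hv₂, mul_one], ?_⟩
        rw [← h₁, ← h₂]
        ring
    have hpres : ∀ r : R', ∃ a ∈ C, ∃ b ∈ C, O.valuation b = 1 ∧ algebraMap R' K r * b = a := by
      intro r
      obtain ⟨τ, σ, hτ, hσ, hσ1, hr⟩ := hup r
      obtain ⟨cτ, hcτ, βτ, hβτ, hvτ, hτe⟩ := hadjC τ hτ
      obtain ⟨cσ, hcσ, βσ, hβσ, hvσ, hσe⟩ := hadjC σ hσ
      refine ⟨cτ * βσ, mul_mem hcτ ((le_sup_left : B₀ ≤ C) hβσ), cσ * βτ,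
        mul_mem hcσ ((le_sup_left : B₀ ≤ C) hβτ), ?_, ?_⟩
      · rw [← hσe, map_mul, map_mul, hσ1, hvσ, hvτ, mul_one, mul_one]
      · calc algebraMap R' K r * (cσ * βτ) = (algebraMap R' K r * σ) * βσ * βτ := by
              rw [← hσe]; ring
          _ = cτ * βσ := by rw [hr, ← hτe]; ring
    have hR'F : ∀ r : R', algebraMap R' K r ∈ F₁ := by
      intro r
      obtain ⟨τ, σ, hτ, hσ, hσ1, hr⟩ := hup r
      have hσ0 : σ ≠ 0 := fun h0 => by rw [h0, map_zero] at hσ1; exact zero_ne_one hσ1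
      have : algebraMap R' K r = τ / σ := by rw [← hr, mul_div_cancel_right₀ _ hσ0]
      rw [this]
      exact div_mem (hadjF τ hτ) (hadjF σ hσ)
    -- the isomorphism `R' ≃ S`
    let g : R' →+* S :=
      { toFun := fun r => ⟨algebraMap R' K r, (hmemS _).mpr ⟨r, rfl⟩⟩
        map_one' := Subtype.ext (map_one _)
        map_mul' := fun a b => Subtype.ext (map_mul _ a b)
        map_zero' := Subtype.ext (map_zero _)
        map_add' := fun a b => Subtype.ext (map_add _ a b) }
    have hg : ∀ r, ((g r : S) : K) = algebraMap R' K r := fun _ => rfl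
    have hgbij : Function.Bijective g := by
      refine ⟨fun a b h => hinj' ?_, fun s => ?_⟩
      · rw [← hg, ← hg, h]
      · obtain ⟨r, hr⟩ := (hmemS s).mp s.2
        exact ⟨r, Subtype.ext hr⟩
    let e : R' ≃+* S := RingEquiv.ofBijective g hgbij
    have he : ∀ r, ((e r : S) : K) = algebraMap R' K r := fun _ => rfl
    have he' : ∀ s : S, algebraMap R' K (e.symm s) = (s : K) := fun s => by
      rw [← he, RingEquiv.apply_symm_apply]
    -- the chart
    have hSchart : RegChart O F₁ S := by
      refine ⟨IsRegularLocalRing.of_ringEquiv e, ?_, ?_, ?_, ?_, C, hCfg, hCS, ?_⟩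
      · intro y hy
        obtain ⟨r, rfl⟩ := (hmemS y).mp (Subalgebra.mem_toSubring.mp hy)
        exact hR'O r
      · intro y hy
        obtain ⟨r, rfl⟩ := (hmemS y).mp hy
        exact hR'F r
      · intro s
        conv_lhs => rw [← e.apply_symm_apply s]
        rw [isUnit_map_iff e, hR'unit, he']
      · intro y hy
        obtain ⟨a, ha, b, hb, hb0, hab⟩ := hfrac y hy
        exact ⟨a, hB₀S ha, b, hB₀S hb, hb0, hab⟩
      · intro y hy
        obtain ⟨r, rfl⟩ := (hmemS y).mp hy
        exact hpres r
    have hd3 : d ≤ 3 := by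
      have h1 := ringKrullDim_le_of_regChart O F₁ hSchart htr
      rw [← ringKrullDim_eq_of_ringEquiv e, hdim'] at h1
      exact_mod_cast h1
    -- the parameters
    have hzm : ∀ j, z j ∈ maximalIdeal R' := fun j => by
      rw [← hspan']; exact Ideal.subset_span ⟨j, rfl⟩
    have hz0 : ∀ j, z j ≠ 0 := by
      intro j hj
      have hcard : (Finset.univ.image z).card ≤ (maximalIdeal R').spanFinrank := by
        have h1 : ((maximalIdeal R').spanFinrank : WithBot ℕ∞) = ringKrullDim R' :=
          IsRegularLocalRing.spanFinrank_maximalIdeal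
        rw [hdim'] at h1
        have h2 : (maximalIdeal R').spanFinrank = d := by exact_mod_cast h1
        rw [h2]
        exact (Finset.card_image_le).trans (by simp)
      have hspan'' : Ideal.span ((Finset.univ.image z : Finset R') : Set R') = maximalIdeal R' := by
        rw [Finset.coe_image, Finset.coe_univ, Set.image_univ, hspan']
      have := not_mem_sq_of_span_eq_maximalIdeal _ hspan'' hcard
        (Finset.mem_image.mpr ⟨j, Finset.mem_univ _, rfl⟩)
      rw [hj] at this
      exact this (Ideal.zero_mem _)
    let t : Fin d → K := fun j => algebraMap R' K (z j)
    have htfam : IsParamFamily O S t := by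
      refine ⟨fun j => ⟨(hmemS _).mpr ⟨z j, rfl⟩, fun h => hz0 j (hinj' (by rw [map_zero]; exact h))⟩,
        d, fun j => e (z j), ?_, ?_, ?_, fun i => Or.inl ⟨i, rfl⟩⟩
      · rw [← ringKrullDim_eq_of_ringEquiv e, hdim']
      · intro j hunit
        rw [isUnit_map_iff e] at hunit
        exact (IsLocalRing.mem_maximalIdeal _).mp (hzm j) hunit   -- mem_maximalIdeal: x ∈ 𝔪 ↔ x ∈ nonunits
      · intro s hs
        have hs' : ¬IsUnit (e.symm s) := fun h => hs (by
          have := (isUnit_map_iff e (e.symm s)).mpr h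
          rwa [RingEquiv.apply_symm_apply] at this)
        have hmem : e.symm s ∈ Ideal.span (Set.range z) := by
          rw [hspan']
          exact (IsLocalRing.mem_maximalIdeal _).mpr hs'
        have := Ideal.mem_map_of_mem (e : R' →+* S) hmem
        rw [Ideal.map_span, ← Set.range_comp] at this
        simpa [Function.comp_def] using this
    refine ⟨S, d, t, hd3, hB₀S, hSchart, htfam, ?_⟩
    -- each `w ∈ W` is a monomial
    intro w hw
    obtain ⟨hwB, hw0⟩ := hW w hw
    obtain ⟨rw, hrw⟩ := hB₀range w hwB
    -- the cofactor of `w` in `xA`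
    let cw : A₀ := a₀ * ∏ x ∈ W.attach.erase ⟨w, hw⟩, wA x.1 x.2
    have hxAw : xA = wA w hw * cw := by
      change a₀ * ∏ x ∈ W.attach, wA x.1 x.2 = wA w hw * (a₀ * _)
      rw [← Finset.mul_prod_erase W.attach (fun x => wA x.1 x.2) (Finset.mem_attach W ⟨w, hw⟩)]
      ring
    obtain ⟨qw, hqw⟩ := hB₀range (cw : K) (Subalgebra.mem_toSubring.mp cw.2)
    have hdiv : u * ∏ i, z i ^ α i = rw * qw := by
      apply hinj'
      rw [← hfact', map_mul, hrw, hqw]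
      change algebraMap R K (algebraMap A₀ R xA) = _
      rw [hφK, hxAw]
      rfl
    have hrw0 : rw ≠ 0 := fun h0 => hw0 (by rw [← hrw, h0, map_zero])
    have hrad : ∏ i, z i ∈ (Ideal.span {rw}).radical := by
      obtain ⟨u', rfl⟩ := hu
      let N : ℕ := ∑ i, α i
      have hαN : ∀ i, α i ≤ N := fun i =>
        Finset.single_le_sum (f := α) (fun i _ => Nat.zero_le _) (Finset.mem_univ i)
      refine ⟨N, ?_⟩
      have hsplit : (∏ i, z i) ^ N = (∏ i, z i ^ α i) * ∏ i, z i ^ (N - α i) := by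
        rw [← Finset.prod_pow, ← Finset.prod_mul_distrib]
        refine Finset.prod_congr rfl fun i _ => ?_
        rw [← pow_add, Nat.add_sub_cancel' (hαN i)]
      rw [hsplit]
      refine Ideal.mul_mem_right _ _ (Ideal.mem_span_singleton'.mpr ⟨qw * ↑u'⁻¹, ?_⟩)
      calc qw * ↑u'⁻¹ * rw = ↑u'⁻¹ * (rw * qw) := by ring
        _ = ∏ i, z i ^ α i := by rw [← hdiv, ← mul_assoc, Units.inv_mul, one_mul]
    have hdim'' : ringKrullDim R' = ((d + 0 : ℕ) : WithBot ℕ∞) := by rw [Nat.add_zero]; exact hdim'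
    have hspan'' : Ideal.span (Set.range z ∪ Set.range (Fin.elim0 : Fin 0 → R')) = maximalIdeal R' := by
      rw [Set.range_eq_empty Fin.elim0, Set.union_empty, hspan']
    obtain ⟨uw, β, huw, hrweq⟩ :=
      exists_isUnit_mul_prod_pow_of_prod_mem_radical z Fin.elim0 hdim'' hspan'' rw hrw0 hrad
    refine ⟨algebraMap R' K uw, (hmemS _).mpr ⟨uw, rfl⟩, (hR'unit uw).mp huw, β, ?_⟩
    rw [← hrw, hrweq, map_mul, map_prod]
    simp only [map_pow]
    rfl
end Summit.ResolutionOfSingularities.ResolutionOfSingularities.Theorems.PerronLadder
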